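/-
Copyright: H21 K2-LIT squad (hodgecm-mathlib). Helper for crux hLiu418 = `stmt-HodgeConjecture-24832`
(route `route-HodgeConjecture-HCCMUnconditional`), G-road arch debt «(D-ht)» (LEAD ruling «M-156h», G2-PS-B, file B2).
-/
import Summits.HodgeConjecture.HodgeConjecture.Theorems.K2LiuSiegelGramDeterminantDefs
import Mathlib.Analysis.Matrix.PosDef
import Mathlib.Analysis.Matrix.Normed
import Mathlib.Analysis.Normed.Algebra.MatrixExponential
import Mathlib.Analysis.SpecialFunctions.Exponential
import Mathlib.Analysis.Calculus.ContDiff.Operations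
import Mathlib.Topology.Algebra.Module.FiniteDimension
import HarnessLib

/-!
# The Siegel Gram determinant: `P_Δ`-equivariance, unitary invariance, positivity, differentiability

For `T, Y ∈ M_{2n}(ℂ)` the Gram determinant ★ `siegelGram T Y = det (Dᴴ (T Y)ᴴ (T Y) D)` (`D = siegelD`, the `2n × n` matrix of the diagonal
`Δ`) satisfies:

1. `siegelBlockTotal_eq` : `siegelBlockTotal H = Dᴴ H D`; `mul_siegelD_of_isSiegelM` : `P D = D · siegelBlockSum P` for `P ∈ P_Δ` (★ `IsSiegelM`);
2. `siegelGram_mul_left_of_unitary` : `siegelGram T (C Y) = siegelGram T Y` whenever `T C = V T` with `Vᴴ V = 1` (right-`C_∞`-invariance: for the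
   majorant frame `T = S⁻¹` of a standard Iwasawa datum and `c ∈ C_∞`, `S⁻¹ c⁻¹ S` is unitary);
3. `siegelGram_mul_right_of_isSiegelM` : `siegelGram T (Y P) = |det_Δ P|² · siegelGram T Y` for `P ∈ P_Δ` (left-`P_Δ`-equivariance, ★ `detDeltaM`);
4. `siegelGram_pos` : `siegelGram T Y` is a positive real for `T, Y` invertible (a Gram determinant of `n` independent vectors, Mathlib
   `Matrix.PosDef.conjTranspose_mul_self`, `PosDef.det_pos`);
5. `contDiff_det`, `contDiff_conjTranspose`, `contDiff_siegelBlockTotal`, `contDiff_siegelGram_mul` : `M ↦ siegelGram T (M Y)` is `C^∞` over `ℝ` (a polynomial in the entries and their conjugates), hence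
   `hasDerivAt_siegelGram_exp_neg` : `t ↦ siegelGram T (exp(−tX) Y)` is differentiable at `0` with derivative `(fderiv f 1)(−X)` — `ℝ`-LINEAR in `X`
   (`exists_clm_hasDerivAt_siegelGram`), which is what makes the height log-derivative `H_X` linear in `X` and `K`-finite downstream.

So for `x ∈ U(n,n)` with Iwasawa decomposition `x = p c`, `siegelGram S⁻¹ x⁻¹ = |det_Δ p|⁻² · siegelGram S⁻¹ 1` computes the archimedean Iwasawa height
along `Δ` without choosing the decomposition. [cite: Weil1964, Chap. I n° 8] [cite: KudlaRallis1994, §1] [cite: GelbartRogawski1991, §3.1 Prop. 3.1.1 p. 455]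
[cite: Knapp2002, 0.§2 (matrix exponential, `d/dt exp(tX) = X exp(tX)`)]
-/

set_option linter.dupNamespace false -- the mandated namespace repeats `HodgeConjecture.HodgeConjecture`

open scoped Matrix ComplexOrder ContDiff
open Literature.NumberTheory.GelbartRogawski1991.GRConstruction
open Summit.HodgeConjecture.HodgeConjecture.Cruxes.HLiu418.K2LiuSiegelGramDeterminantDefs

namespace Summit.HodgeConjecture.HodgeConjecture.Cruxes.HLiu418.K2LiuSiegelGramDeterminant

variable {n : ℕ}

/-! ## 1. Block algebra along the diagonal `Δ` -/

section Blocks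

variable {R : Type*}

/-- a `2n × 2n` matrix is its block matrix re-enumerated by `e₂`. [cite: GelbartRogawski1991, §3.1 Prop. 3.1.1 p. 455] -/
theorem eq_submatrix_fromBlocks (M : Matrix (Fin (n + n)) (Fin (n + n)) R) :
    M = (Matrix.fromBlocks (Matrix.reindex (e₂ (n := n)).symm (e₂ (n := n)).symm M).toBlocks₁₁
          (Matrix.reindex (e₂ (n := n)).symm (e₂ (n := n)).symm M).toBlocks₁₂
          (Matrix.reindex (e₂ (n := n)).symm (e₂ (n := n)).symm M).toBlocks₂₁
          (Matrix.reindex (e₂ (n := n)).symm (e₂ (n := n)).symm M).toBlocks₂₂).submatrix (e₂ (n := n)).symm (e₂ (n := n)).symm := by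
  rw [Matrix.fromBlocks_toBlocks]
  ext i j
  simp only [Matrix.reindex_apply, Matrix.submatrix_apply, Equiv.symm_symm, Equiv.apply_symm_apply]

variable [CommRing R]

/-- `siegelD = [1; 1] ∘ e₂` (definitional unfolding). [cite: GelbartRogawski1991, §3.1 Prop. 3.1.1 p. 455] -/
theorem siegelD_eq_submatrix :
    siegelD n R = (Matrix.fromRows (1 : Matrix (Fin n) (Fin n) R) 1).submatrix (e₂ (n := n)).symm id := rfl

/-- **`P ∈ P_Δ ⇒ P D = D · (P₁₁ + P₁₂)`**: a matrix satisfying the Siegel relation acts on the diagonal `Δ` through its block sum.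
[cite: GelbartRogawski1991, §3.1 Prop. 3.1.1 p. 455] -/
theorem mul_siegelD_of_isSiegelM {P : Matrix (Fin (n + n)) (Fin (n + n)) R} (hP : IsSiegelM P) :
    P * siegelD n R = siegelD n R * siegelBlockSum P := by
  set B := Matrix.reindex (e₂ (n := n)).symm (e₂ (n := n)).symm P with hB
  have hS : B.toBlocks₁₁ + B.toBlocks₁₂ = B.toBlocks₂₁ + B.toBlocks₂₂ := hP
  have hsum : siegelBlockSum P = B.toBlocks₁₁ + B.toBlocks₁₂ := rfl
  conv_lhs => rw [eq_submatrix_fromBlocks P]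
  rw [siegelD_eq_submatrix, Matrix.submatrix_mul_equiv (e₂ := (e₂ (n := n)).symm), Matrix.fromBlocks_mul_fromRows, Matrix.mul_one,
    Matrix.mul_one, Matrix.mul_one, Matrix.mul_one, ← hB, ← hS, hsum]
  have h2 : (Matrix.fromRows (1 : Matrix (Fin n) (Fin n) R) 1).submatrix (e₂ (n := n)).symm id * (B.toBlocks₁₁ + B.toBlocks₁₂) =
      (Matrix.fromRows (1 : Matrix (Fin n) (Fin n) R) 1 * (B.toBlocks₁₁ + B.toBlocks₁₂)).submatrix (e₂ (n := n)).symm id := by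
    rw [← Matrix.submatrix_mul_equiv (e₂ := Equiv.refl (Fin n)) (e₃ := (id : Fin n → Fin n))]
    rfl
  rw [h2, Matrix.fromRows_mul, Matrix.one_mul]

variable [StarRing R]

/-- **`siegelBlockTotal H = Dᴴ H D`**: the total block sum is the compression of `H` to the diagonal. [cite: GelbartRogawski1991, §3.1 Prop. 3.1.1 p. 455] -/
theorem siegelBlockTotal_eq (H : Matrix (Fin (n + n)) (Fin (n + n)) R) :
    siegelBlockTotal H = (siegelD n R)ᴴ * H * siegelD n R := by
  set B := Matrix.reindex (e₂ (n := n)).symm (e₂ (n := n)).symm H with hB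
  have htot : siegelBlockTotal H = B.toBlocks₁₁ + B.toBlocks₁₂ + (B.toBlocks₂₁ + B.toBlocks₂₂) := rfl
  rw [htot]
  conv_rhs => rw [eq_submatrix_fromBlocks H]
  rw [← hB, siegelD_eq_submatrix, Matrix.conjTranspose_submatrix, Matrix.conjTranspose_fromRows_eq_fromCols_conjTranspose,
    Matrix.conjTranspose_one, Matrix.submatrix_mul_equiv (e₂ := (e₂ (n := n)).symm),
    Matrix.submatrix_mul_equiv (M := Matrix.fromCols 1 1 * Matrix.fromBlocks B.toBlocks₁₁ B.toBlocks₁₂ B.toBlocks₂₁ B.toBlocks₂₂)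
      (e₁ := (id : Fin n → Fin n)) (e₂ := (e₂ (n := n)).symm) (e₃ := (id : Fin n → Fin n)),
    Matrix.fromCols_mul_fromBlocks, Matrix.one_mul, Matrix.one_mul, Matrix.one_mul, Matrix.one_mul, Matrix.fromCols_mul_fromRows,
    Matrix.mul_one, Matrix.mul_one, Matrix.submatrix_id_id, add_add_add_comm]

/-- `siegelGram T Y = det ((T Y D)ᴴ (T Y D))`. [cite: KudlaRallis1994, §1] -/
theorem siegelGram_eq_det (T Y : Matrix (Fin (n + n)) (Fin (n + n)) ℂ) :
    siegelGram T Y = ((T * Y * siegelD n ℂ)ᴴ * (T * Y * siegelD n ℂ)).det := by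
  simp only [siegelGram_def, siegelBlockTotal_eq, Matrix.conjTranspose_mul, Matrix.mul_assoc]

end Blocks

/-! ## 2. Invariance under unitaries on the left, `P_Δ`-equivariance on the right, positivity -/

section Invariance

/-- **unitary invariance**: if `T C = V T` with `V` unitary (`Vᴴ V = 1`) then `siegelGram T (C Y) = siegelGram T Y`. For the frame `T = S⁻¹` of a
standard Iwasawa datum and `c ∈ C_∞ = H_∞ ∩ S·U(2n)·S⁻¹` this is the right-`C_∞`-invariance of `x ↦ siegelGram S⁻¹ x⁻¹` (`C = c⁻¹`, `V = S⁻¹c⁻¹S`).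
[cite: Weil1964, Chap. I n° 8] -/
theorem siegelGram_mul_left_of_unitary (T Y C V : Matrix (Fin (n + n)) (Fin (n + n)) ℂ) (hV : Vᴴ * V = 1) (hTC : T * C = V * T) :
    siegelGram T (C * Y) = siegelGram T Y := by
  have h1 : T * (C * Y) = V * (T * Y) := by rw [← Matrix.mul_assoc, hTC, Matrix.mul_assoc]
  have h2 : (V * (T * Y))ᴴ * (V * (T * Y)) = (T * Y)ᴴ * (T * Y) := by
    rw [Matrix.conjTranspose_mul, Matrix.mul_assoc, ← Matrix.mul_assoc Vᴴ V (T * Y), hV, Matrix.one_mul]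
  rw [siegelGram_def, siegelGram_def, h1, h2]

/-- **`P_Δ`-equivariance**: for `P` with the Siegel relation, `siegelGram T (Y P) = det_Δ(P)^* · det_Δ(P) · siegelGram T Y` (`P D = D A`, `A = P₁₁ + P₁₂`,
so `Dᴴ Pᴴ H P D = Aᴴ (Dᴴ H D) A`). For `Y = x⁻¹`, `P = p⁻¹` this is the left-`P_Δ`-equivariance of `x ↦ siegelGram S⁻¹ x⁻¹` with factor `|det_Δ p|⁻²`.
[cite: KudlaRallis1994, §1] [cite: GelbartRogawski1991, §3.1 Prop. 3.1.1 p. 455] -/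
theorem siegelGram_mul_right_of_isSiegelM (T Y : Matrix (Fin (n + n)) (Fin (n + n)) ℂ) {P : Matrix (Fin (n + n)) (Fin (n + n)) ℂ}
    (hP : IsSiegelM P) :
    siegelGram T (Y * P) = star (detDeltaM P) * detDeltaM P * siegelGram T Y := by
  rw [siegelGram_eq_det, siegelGram_eq_det, detDeltaM_eq_det_siegelBlockSum]
  have h1 : T * (Y * P) * siegelD n ℂ = T * Y * siegelD n ℂ * siegelBlockSum P := by
    rw [Matrix.mul_assoc, Matrix.mul_assoc, mul_siegelD_of_isSiegelM hP, ← Matrix.mul_assoc, ← Matrix.mul_assoc]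
  have h2 : (T * Y * siegelD n ℂ * siegelBlockSum P)ᴴ * (T * Y * siegelD n ℂ * siegelBlockSum P) =
      (siegelBlockSum P)ᴴ * (((T * Y * siegelD n ℂ)ᴴ * (T * Y * siegelD n ℂ)) * siegelBlockSum P) := by
    rw [Matrix.conjTranspose_mul]
    simp only [Matrix.mul_assoc]
  rw [h1, h2, Matrix.det_mul, Matrix.det_mul, Matrix.det_conjTranspose]
  ring

/-- `D` is injective: `D v = 0 ⇒ v = 0` (the `e₂ (inl i)`-th coordinate of `D v` is `v i`). [cite: GelbartRogawski1991, §3.1 Prop. 3.1.1 p. 455] -/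
theorem siegelD_mulVec_injective : Function.Injective (siegelD n ℂ).mulVec := by
  intro v w hvw
  funext i
  have h := congrFun hvw (e₂ (n := n) (Sum.inl i))
  simpa [siegelD_eq_submatrix, Matrix.submatrix_mulVec_equiv, Matrix.mulVec, Matrix.fromRows_apply_inl, Matrix.one_apply,
    dotProduct] using h

/-- **positivity**: for invertible `T, Y` the Gram determinant `siegelGram T Y` is a positive real (the Gram matrix of the `n` independent columns of
`T Y D` is positive definite). [cite: Weil1964, Chap. I n° 8] -/
theorem siegelGram_pos (T Y : Matrix (Fin (n + n)) (Fin (n + n)) ℂ) (hT : IsUnit T) (hY : IsUnit Y) :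
    ∃ r : ℝ, 0 < r ∧ siegelGram T Y = r := by
  have hinj : Function.Injective (T * Y * siegelD n ℂ).mulVec := by
    intro v w hvw
    apply siegelD_mulVec_injective
    have hTY : IsUnit (T * Y) := hT.mul hY
    apply (Matrix.mulVec_injective_iff_isUnit.2 hTY)
    simpa only [Matrix.mulVec_mulVec] using hvw
  have hpd : ((T * Y * siegelD n ℂ)ᴴ * (T * Y * siegelD n ℂ)).PosDef := Matrix.PosDef.conjTranspose_mul_self _ hinj
  have hdet := hpd.det_pos
  rw [← siegelGram_eq_det] at hdet
  obtain ⟨hre, him⟩ := Complex.pos_iff.1 hdet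
  refine ⟨(siegelGram T Y).re, hre, ?_⟩
  exact Complex.ext rfl (by rw [Complex.ofReal_im]; exact him.symm)

end Invariance

/-! ## 3. Differentiability -/

section Calculus

-- The operator (`L∞–L¹`) norm on matrices: the setting in which Mathlib differentiates `NormedSpace.exp` (as in
-- `Mathlib/Analysis/Normed/Algebra/MatrixExponential.lean`); all norms on these finite-dimensional spaces are equivalent.
open scoped Matrix.Norms.Operator

set_option backward.isDefEq.respectTransparency false

/-- **the determinant is smooth** (a polynomial in the entries; each entry is a continuous `ℝ`-linear functional). [cite: Knapp2002, 0.§2] -/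
theorem contDiff_det {m : ℕ} : ContDiff ℝ ∞ fun M : Matrix (Fin m) (Fin m) ℂ => M.det := by
  have h : (fun M : Matrix (Fin m) (Fin m) ℂ => M.det) =
      fun M => ∑ σ : Equiv.Perm (Fin m), ((Equiv.Perm.sign σ : ℤ) : ℂ) *
        ∏ i, LinearMap.toContinuousLinearMap (Matrix.entryLinearMap ℝ ℂ (σ i) i) M := by
    funext M
    rw [Matrix.det_apply']
    rfl
  rw [h]
  refine ContDiff.sum fun σ _ => contDiff_const.mul ?_
  exact contDiff_prod fun i _ => (LinearMap.toContinuousLinearMap (Matrix.entryLinearMap ℝ ℂ (σ i) i)).contDiff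

/-- conjugate transposition `M ↦ Mᴴ` is smooth (a continuous `ℝ`-linear map). [cite: Knapp2002, 0.§2] -/
theorem contDiff_conjTranspose {m k : ℕ} : ContDiff ℝ ∞ fun M : Matrix (Fin m) (Fin k) ℂ => Mᴴ :=
  (LinearMap.toContinuousLinearMap
    ({ toFun := fun M => Mᴴ
       map_add' := fun M N => Matrix.conjTranspose_add M N
       map_smul' := fun r M => by rw [Matrix.conjTranspose_smul, RingHom.id_apply, star_trivial] } :
      Matrix (Fin m) (Fin k) ℂ →ₗ[ℝ] Matrix (Fin k) (Fin m) ℂ)).contDiff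

/-- the total block sum `H ↦ H₁₁ + H₁₂ + H₂₁ + H₂₂` is smooth (a continuous `ℝ`-linear map). [cite: GelbartRogawski1991, §3.1 Prop. 3.1.1 p. 455] -/
theorem contDiff_siegelBlockTotal : ContDiff ℝ ∞ fun H : Matrix (Fin (n + n)) (Fin (n + n)) ℂ => siegelBlockTotal H :=
  (LinearMap.toContinuousLinearMap
    ({ toFun := fun H => siegelBlockTotal H
       map_add' := fun H H' => by
         ext i j
         simp only [siegelBlockTotal, Matrix.reindex_apply, Matrix.toBlocks₁₁, Matrix.toBlocks₁₂, Matrix.toBlocks₂₁,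
           Matrix.toBlocks₂₂, Matrix.add_apply, Matrix.of_apply, Matrix.submatrix_apply]
         ring
       map_smul' := fun r H => by
         ext i j
         simp only [siegelBlockTotal, Matrix.reindex_apply, Matrix.toBlocks₁₁, Matrix.toBlocks₁₂, Matrix.toBlocks₂₁,
           Matrix.toBlocks₂₂, Matrix.add_apply, Matrix.of_apply, Matrix.submatrix_apply, Matrix.smul_apply,
           RingHom.id_apply, smul_add] } :
      Matrix (Fin (n + n)) (Fin (n + n)) ℂ →ₗ[ℝ] Matrix (Fin n) (Fin n) ℂ)).contDiff

/-- **`M ↦ siegelGram T (M Y)` is smooth** (composition of `det`, the block-total map, `W ↦ Wᴴ W` and `M ↦ T M Y`). [cite: KudlaRallis1994, §1] -/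
theorem contDiff_siegelGram_mul (T Y : Matrix (Fin (n + n)) (Fin (n + n)) ℂ) :
    ContDiff ℝ ∞ fun M : Matrix (Fin (n + n)) (Fin (n + n)) ℂ => siegelGram T (M * Y) := by
  have h : (fun M : Matrix (Fin (n + n)) (Fin (n + n)) ℂ => siegelGram T (M * Y)) =
      (fun A : Matrix (Fin n) (Fin n) ℂ => A.det) ∘ (fun H : Matrix (Fin (n + n)) (Fin (n + n)) ℂ => siegelBlockTotal H) ∘
        fun M : Matrix (Fin (n + n)) (Fin (n + n)) ℂ => (T * (M * Y))ᴴ * (T * (M * Y)) := by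
    funext M
    simp only [Function.comp_apply, siegelGram_def]
  rw [h]
  refine contDiff_det.comp (contDiff_siegelBlockTotal.comp ?_)
  have hlin : ContDiff ℝ ∞ fun M : Matrix (Fin (n + n)) (Fin (n + n)) ℂ => T * (M * Y) :=
    contDiff_const.mul (contDiff_id.mul contDiff_const)
  exact (contDiff_conjTranspose.comp hlin).mul hlin

/-- the path `t ↦ exp(−tX)` has derivative `−X` at `t = 0`. [cite: Knapp2002, 0.§2 Prop. 0.11] -/
theorem hasDerivAt_exp_neg_smul_zero (X : Matrix (Fin (n + n)) (Fin (n + n)) ℂ) :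
    HasDerivAt (fun t : ℝ => NormedSpace.exp (-(t • X))) (-X) 0 := by
  have h1 : HasDerivAt (fun u : ℝ => NormedSpace.exp (u • X)) (NormedSpace.exp ((-0 : ℝ) • X) * X) (-0) :=
    hasDerivAt_exp_smul_const X (-0)
  have h2 := h1.scomp (0 : ℝ) (hasDerivAt_neg (0 : ℝ))
  have h3 : ((fun u : ℝ => NormedSpace.exp (u • X)) ∘ fun t : ℝ => -t) = fun t : ℝ => NormedSpace.exp (-(t • X)) := by
    funext t
    simp only [Function.comp_apply, neg_smul]
  rw [h3] at h2
  simpa only [neg_zero, zero_smul, NormedSpace.exp_zero, one_mul, neg_one_smul] using h2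

/-- **derivative of the Gram determinant along `t ↦ exp(−tX) · Y`** at `t = 0`: it is the Fréchet derivative of `M ↦ siegelGram T (M Y)` at `M = 1`
applied to `−X`. [cite: KudlaRallis1994, §1] [cite: Knapp2002, 0.§2 Prop. 0.11] -/
theorem hasDerivAt_siegelGram_exp_neg (T Y X : Matrix (Fin (n + n)) (Fin (n + n)) ℂ) :
    HasDerivAt (fun t : ℝ => siegelGram T (NormedSpace.exp (-(t • X)) * Y))
      ((fderiv ℝ (fun M : Matrix (Fin (n + n)) (Fin (n + n)) ℂ => siegelGram T (M * Y)) 1) (-X)) 0 := by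
  have hf := (((contDiff_siegelGram_mul T Y).differentiable (by simp)).differentiableAt
    (x := (1 : Matrix (Fin (n + n)) (Fin (n + n)) ℂ))).hasFDerivAt
  have hp := hasDerivAt_exp_neg_smul_zero X
  have h0 : NormedSpace.exp (-((0 : ℝ) • X)) = (1 : Matrix (Fin (n + n)) (Fin (n + n)) ℂ) := by
    rw [zero_smul, neg_zero, NormedSpace.exp_zero]
  exact hf.comp_hasDerivAt_of_eq (0 : ℝ) hp h0.symm

/-- **the derivative at `0` of `t ↦ siegelGram T (exp(−tX) Y)` is an `ℝ`-linear function of `X`** (packaged: one continuous linear map `φ` for all `X`).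
[cite: KudlaRallis1994, §1] -/
theorem exists_clm_hasDerivAt_siegelGram (T Y : Matrix (Fin (n + n)) (Fin (n + n)) ℂ) :
    ∃ φ : Matrix (Fin (n + n)) (Fin (n + n)) ℂ →L[ℝ] ℂ,
      ∀ X : Matrix (Fin (n + n)) (Fin (n + n)) ℂ, HasDerivAt (fun t : ℝ => siegelGram T (NormedSpace.exp (-(t • X)) * Y)) (φ X) 0 := by
  exact ⟨(fderiv ℝ (fun M : Matrix (Fin (n + n)) (Fin (n + n)) ℂ => siegelGram T (M * Y)) 1).comp
      (-ContinuousLinearMap.id ℝ (Matrix (Fin (n + n)) (Fin (n + n)) ℂ)), fun X => hasDerivAt_siegelGram_exp_neg T Y X⟩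

end Calculus

end Summit.HodgeConjecture.HodgeConjecture.Cruxes.HLiu418.K2LiuSiegelGramDeterminant
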